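import Summits.AnomalousDissipation.AnomalousDissipation.Theses.TameRoughRigidity
import Summits.AnomalousDissipation.AnomalousDissipation.Theorems.GPStatisticalRigidity.Negative.LoadBearing
import Summits.AnomalousDissipation.AnomalousDissipation.Theorems.GPStatisticalRigidity.Negative.IntegrableRedundant
import Summits.AnomalousDissipation.AnomalousDissipation.Theorems.GPStatisticalRigidity.Negative.EulerSSS

/-!
# `TameRoughRigidity.TameToRough` (stmt-AnomalousDissipation-18401) is exactly the residual of the target
# modulo the other two cruxes — negative side (refutability analysis)

Refuter crux-attack at birth (`refuter-rattack-stmt-AnomalousDissipation-18401-0`, 2026-08-17). Kernel-checked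
LOGICAL STRUCTURE of the crux R = `TameToRough` (conditional Onsager calibration) inside its route
(N = `GPEulerCoercive`, K = `TameClosure`, X = `GPStatisticalRigidity`); nothing here asserts a Theses statement.

* `tameGap_iff` — the ANTECEDENT of R (a positive cylindrical-defect gap on every tame class `(E, G₁)` of
  probability measures on `H`) is EQUIVALENT to `N ∧ K`: a stationary statistical solution of Euler forced by
  `f_GP` is a tame measure with defect `0` at its own level (gap ⇒ N, via `exactEulerStatistics_of_sss`); under the
  gap the hypothesis of K is contradictory (gap ⇒ K vacuously); N ∧ K ⇒ gap is the planner's contraposition.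
* `tameToRough_iff_imp` — hence **R ↔ (N → K → X)**: R carries exactly the content of X that N ∧ K do not
  (→ is the route's RigiditySplit, patching `δ₀' = min δ₀ (r/2)`; ← because X implies R's conclusion with any
  threshold, e.g. `G₁ = 0`). In particular the enstrophy-threshold clause `ofReal G₁ ≤ ensembleEnstrophy μ` of R is
  logically idle given the antecedent (a free WLOG for the prover).
* `not_tameToRough_iff` — **¬R ↔ (N ∧ K ∧ ¬X)**: an unconditional refutation of R is a PROOF of N (no stationary
  Euler statistics of `f_GP` in the FMRT class — an open existence problem, FGHV arXiv:1404.1098 §2.3) and of K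
  together with a refutation of X. No cheap falsifier of R exists in principle; numerical violating families
  (mollified dodgers with `R√G → 0`) are evidence against X only.
-/

noncomputable section

open MeasureTheory UnitAddTorus
open scoped InnerProductSpace ENNReal

set_option linter.dupNamespace false

namespace Summit.AnomalousDissipation.AnomalousDissipation.Theorems.TameToRough.Negative

open Literature.Analysis.FunctionSpaces Literature.Analysis.FluidPDE
open Summit.AnomalousDissipation.AnomalousDissipation.Theses.TameRoughRigidity
open Summit.AnomalousDissipation.AnomalousDissipation.Theorems.GPStatisticalRigidity.Negative

/-- **The tame defect gap is exactly N ∧ K.** The left side is the antecedent of `TameToRough` at the pinned force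
(`DefectLE` of `GPStatisticalRigidity.Negative.LoadBearing` is its defect clause verbatim). -/
theorem tameGap_iff :
    (∀ E G₁ : ℝ, ∃ r : ℝ, 0 < r ∧ ∀ μ : Measure (Torus.energySpace (Fin 3)), IsProbabilityMeasure μ →
      Integrable (fun v : Torus.energySpace (Fin 3) => ‖v‖ ^ 2) μ → Torus.ensembleEnergy μ ≤ E →
        Torus.ensembleEnstrophy μ ≤ ENNReal.ofReal G₁ → ¬ DefectLE gpForce μ r) ↔
    (GPEulerCoercive ∧ TameClosure) := by
  constructor
  · intro hg
    constructor
    · -- gap ⇒ N: an Euler SSS of f_GP is tame and exact at its own level (E, G)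
      intro f hf μ hsss
      subst hf
      have hex := exactEulerStatistics_of_sss hsss
      obtain ⟨r, hr, hgap⟩ := hg (Torus.ensembleEnergy μ) (Torus.ensembleEnstrophy μ).toReal
      refine hgap μ hex.1 hex.2.1 le_rfl ?_ (defectLE_of_exact hex hr.le)
      rw [ENNReal.ofReal_toReal hex.2.2.1.ne]
    · -- gap ⇒ K vacuously: K's near-exact tame family at (E, G₁) contradicts the gap r(E, G₁)
      intro f hf E G₁ hnear
      subst hf
      obtain ⟨r, hr, hgap⟩ := hg E G₁
      obtain ⟨μ, hp, hi, hE, hG, hdef⟩ := hnear r hr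
      exact absurd hdef (hgap μ hp hi hE hG)
  · -- N ∧ K ⇒ gap (contraposition of the closure lemma; route file `closes`, step (1))
    rintro ⟨h₁, h₂⟩ E' G₁
    by_contra hcon
    push Not at hcon
    obtain ⟨μ, hμ, -⟩ := h₂ gpForce rfl E' G₁ (fun r hr => by
      obtain ⟨μ, hp, hi, hE, hG, hd⟩ := hcon r hr
      exact ⟨μ, hp, hi, hE, hG, hd⟩)
    exact h₁ gpForce rfl μ hμ

/-- **R ↔ (N → K → X)**: the crux is exactly the target conditioned on the other two cruxes. -/
theorem tameToRough_iff_imp : TameToRough ↔ (GPEulerCoercive → TameClosure → GPStatisticalRigidity) := by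
  constructor
  · -- the route's RigiditySplit: N ∧ K give the gap; R gives (G₁, c, δ₀); patch with δ₀' = min δ₀ (r/2)
    intro h₃ h₁ h₂ f hf E
    subst hf
    have gap := tameGap_iff.2 ⟨h₁, h₂⟩
    obtain ⟨G₁, c, δ₀, hc, hδ₀, hrough⟩ := h₃ gpForce rfl gap E
    obtain ⟨r, hr, hgap⟩ := gap E G₁
    refine ⟨c, min δ₀ (r / 2), hc, lt_min hδ₀ (by linarith), ?_⟩
    intro μ hprob hint hE hfin hshell R hR0 hRle hdef
    by_cases hcase : ENNReal.ofReal G₁ ≤ Torus.ensembleEnstrophy μ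
    · exact hrough μ hprob hint hE hfin hcase hshell R hR0 (hRle.trans (min_le_left _ _)) hdef
    · exfalso
      refine hgap μ hprob hint hE (not_le.mp hcase).le ?_
      intro Φ
      obtain ⟨hi, hb⟩ := hdef Φ
      refine ⟨hi, hb.trans ?_⟩
      have hRr : R ≤ r := hRle.trans ((min_le_right _ _).trans (by linarith))
      exact mul_le_mul_of_nonneg_right hRr (Real.sqrt_nonneg _)
  · -- conversely: under the gap N and K hold, so X holds, and X gives R's conclusion with threshold G₁ = 0
    intro h f hf gap E
    subst hf
    obtain ⟨hN, hK⟩ := tameGap_iff.1 gap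
    obtain ⟨c, δ₀, hc, hδ₀, hrig⟩ := h hN hK gpForce rfl E
    exact ⟨0, c, δ₀, hc, hδ₀, fun μ hp hi hE hfin _ hshell R hR0 hRδ hdef => hrig μ hp hi hE hfin hshell R hR0 hRδ hdef⟩

/-- **¬R ↔ (N ∧ K ∧ ¬X)**: refuting the crux means proving N and K and refuting the target. -/
theorem not_tameToRough_iff : ¬ TameToRough ↔ (GPEulerCoercive ∧ TameClosure ∧ ¬ GPStatisticalRigidity) := by
  rw [tameToRough_iff_imp]
  tauto

end Summit.AnomalousDissipation.AnomalousDissipation.Theorems.TameToRough.Negative
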